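import Literature.NumberTheory.EllipticCurves.Greenberg1999.TwoTorsionDiscriminantConfigurationProofs
import HarnessLib

/-!
# Greenberg's "odd" condition as an EXACT RATIONAL SIGN TEST: `⟨P⟩ ⊆ C_∞ ⟺ β > 0 ∧ (α < 0 ∨ α² < 32β)`,
# `α = b₂ + 12x(P)`, `β = b₄ + x(P)b₂ + 6x(P)²` (proofs only)

Topic `NumberTheory/EllipticCurves/Greenberg1999`; theorem-only companion (no definition, no named fact, no instance,
no `sorry`) of `TwoTorsionMuInvariant`, whose predicate `TwoTorsionOdd W x` ("`x` is the LEAST real root of the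
`2`-division cubic `4X³ + b₂X² + 2b₄X + b₆`", Greenberg LNM 1716 §5 Remark p. 121 / p. 123: "the point in `E(ℝ)[2]`
whose `x`-coordinate is minimal") quantifies over real numbers.  Class files and census scripts need a DECIDABLE form:
here it is reduced to sign conditions on two rational numbers attached to the equation and the abscissa.

With `x = x(P)` a rational `2`-torsion abscissa, the other two (complex) `2`-torsion abscissae are the roots of
`X² + (α/4)X + β/2` shifted by `x`, where `α = b₂ + 12x`, `β = b₄ + x·b₂ + 6x²` (`4a₂`, `2a₄` of the normal form at
`P`; siblings `four_mul_a₂_of_isTwoTorsionNF_smul`, `two_mul_a₄_of_isTwoTorsionNF_smul`), and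
`4Δ = β²(α² − 32β)` (`four_mul_Δ_eq_of_isTwoTorsionNF_smul`).

**Theorems.**
* §1 real algebra: for `b ≠ 0`, `a² ≠ 4b`, «every real root of `X² + aX + b` is `≥ 0`» ⟺ `0 < b ∧ (a < 0 ∨ a² < 4b)`
  (`forall_root_nonneg_iff_sign`), and «every real root is `≤ 0`» ⟺ `0 < b ∧ (0 < a ∨ a² < 4b)`.
* §2 on a normal form `y² = x(x² + ax + b)`: `TwoTorsionOdd V 0 ⟺ 0 < b ∧ (a < 0 ∨ a² < 4b)`.
* §3 **`twoTorsionOdd_iff_sign`** — for any `W/ℚ` (elliptic) and any normal form `C • W` (`P = (C.r, C.t)`):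
  `TwoTorsionOdd W C.r ⟺ 0 < β ∧ (α < 0 ∨ α² < 32β)`; co-odd («`x(P)` is the LARGEST real `2`-torsion abscissa»)
  ⟺ `0 < β ∧ (0 < α ∨ α² < 32β)`; and `Δ < 0 ⟺ α² < 32β`, `0 < Δ ⟺ 32β < α²` (`Δ_neg_iff_sign`).  Abscissa forms
  `twoTorsionOdd_iff_sign'` for `HasRationalTwoTorsionX W x`.
* §4 hence DECIDABLE forms of Greenberg's configurations at a good ordinary `2` (with the `2`-adic sibling
  `v₂(x) < 0`): Prop. 5.14's hypothesis, Prop. 5.13's, «neither», all as sign/valuation conditions on `(x, α, β)`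
  (`prop513Hypothesis_iff_sign`, `prop514Hypothesis_iff_sign`).

Written for the BSD cell `bsd-2adic` (stratum (β) census and class files).  Nothing about BSD, `μ` or `λ` is claimed.

## References
* [GreenbergLNM1716] R. Greenberg, *Iwasawa theory for elliptic curves*, LNM 1716 (1999), §5 Remark (chunks p0170,
  p0174; printed pp. 121, 123).
* [SilvermanAEC2009] J. H. Silverman, *AEC*, III.1, III.2.3.
-/

set_option autoImplicit false

open WeierstrassCurve

namespace Literature.NumberTheory.EllipticCurves.Greenberg1999

/-! ### §1. Real algebra: all real roots of `X² + aX + b` on one side of `0` -/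

/-- **All real roots of `X² + aX + b` are `≥ 0` ⟺ `0 < b ∧ (a < 0 ∨ a² < 4b)`** (`b ≠ 0`, `a² ≠ 4b`): `b < 0` gives
roots of both signs; `b > 0`, `a² < 4b` no real root; `b > 0`, `a² > 4b` two roots of the sign of `-a`. [folklore] -/
private theorem forall_root_nonneg_iff_sign {a b : ℝ} (hb : b ≠ 0) (hab : a ^ 2 - 4 * b ≠ 0) :
    (∀ ρ : ℝ, ρ ^ 2 + a * ρ + b = 0 → 0 ≤ ρ) ↔ 0 < b ∧ (a < 0 ∨ a ^ 2 < 4 * b) := by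
  constructor
  · intro h
    rcases lt_or_gt_of_ne hb with hb | hb
    · -- `b < 0`: the root `(-a - √D)/2` is negative
      exfalso
      have hD : 0 < a ^ 2 - 4 * b := by nlinarith [sq_nonneg a]
      set d := Real.sqrt (a ^ 2 - 4 * b) with hd
      have hd2 : d ^ 2 = a ^ 2 - 4 * b := by rw [hd, Real.sq_sqrt hD.le]
      have hda : |a| < d := by
        rw [hd, ← Real.sqrt_sq_eq_abs]
        exact Real.sqrt_lt_sqrt (sq_nonneg a) (by linarith)
      have hneg : (-a - d) / 2 < 0 := by have := neg_abs_le a; linarith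
      exact absurd (h _ (by nlinarith [hd2])) (not_le.mpr hneg)
    · refine ⟨hb, ?_⟩
      rcases lt_or_gt_of_ne hab with hD | hD
      · exact Or.inr (by linarith)
      · left
        by_contra ha
        have ha' : 0 ≤ a := not_lt.mp ha
        set d := Real.sqrt (a ^ 2 - 4 * b) with hd
        have hd2 : d ^ 2 = a ^ 2 - 4 * b := by rw [hd, Real.sq_sqrt hD.le]
        have hd0 : 0 < d := by rw [hd]; exact Real.sqrt_pos.mpr hD
        have hneg : (-a - d) / 2 < 0 := by linarith
        exact absurd (h _ (by nlinarith [hd2])) (not_le.mpr hneg)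
  · rintro ⟨hb, ha | hD⟩ ρ hρ
    · -- `b > 0`, `a < 0`: `ρ(ρ + a) = -b < 0` forces `ρ > 0`
      nlinarith
    · -- no real root
      exfalso
      nlinarith [sq_nonneg (2 * ρ + a)]

/-- **All real roots of `X² + aX + b` are `≤ 0` ⟺ `0 < b ∧ (0 < a ∨ a² < 4b)`** (substitute `X ↦ -X`). [folklore] -/
private theorem forall_root_nonpos_iff_sign {a b : ℝ} (hb : b ≠ 0) (hab : a ^ 2 - 4 * b ≠ 0) :
    (∀ ρ : ℝ, ρ ^ 2 + a * ρ + b = 0 → ρ ≤ 0) ↔ 0 < b ∧ (0 < a ∨ a ^ 2 < 4 * b) := by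
  have h := forall_root_nonneg_iff_sign (a := -a) hb (by simpa using hab)
  have hsq : (-a) ^ 2 = a ^ 2 := by ring
  rw [hsq, neg_lt_zero] at h
  rw [← h]
  constructor
  · intro H ρ hρ
    have := H (-ρ) (by linear_combination hρ)
    linarith
  · intro H ρ hρ
    have := H (-ρ) (by linear_combination hρ)
    linarith

/-! ### §2. On a normal form -/

section NF

variable (V : WeierstrassCurve ℚ) [V.IsTwoTorsionNF] [V.IsElliptic]

/-- **`T = (0,0)` on `y² = x(x² + ax + b)` is odd ⟺ `0 < b ∧ (a < 0 ∨ a² < 4b)`.**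
[cite: GreenbergLNM1716, §5 Remark (chunk p0174)] -/
theorem twoTorsionOdd_zero_iff_sign_of_isTwoTorsionNF :
    TwoTorsionOdd V 0 ↔ 0 < V.a₄ ∧ (V.a₂ < 0 ∨ V.a₂ ^ 2 < 4 * V.a₄) := by
  rw [twoTorsionOdd_zero_iff_of_isTwoTorsionNF]
  have hb : (V.a₄ : ℝ) ≠ 0 := by exact_mod_cast V.a₄_ne_zero
  have hab : (V.a₂ : ℝ) ^ 2 - 4 * (V.a₄ : ℝ) ≠ 0 := by exact_mod_cast V.a₂_sq_sub_ne_zero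
  rw [forall_root_nonneg_iff_sign hb hab]
  constructor
  · rintro ⟨h1, h2 | h2⟩
    · exact ⟨by exact_mod_cast h1, Or.inl (by exact_mod_cast h2)⟩
    · exact ⟨by exact_mod_cast h1, Or.inr (by exact_mod_cast h2)⟩
  · rintro ⟨h1, h2 | h2⟩
    · exact ⟨by exact_mod_cast h1, Or.inl (by exact_mod_cast h2)⟩
    · exact ⟨by exact_mod_cast h1, Or.inr (by exact_mod_cast h2)⟩

/-- **Co-odd at `T = (0,0)` (every real `2`-torsion abscissa `≤ 0`) ⟺ `0 < b ∧ (0 < a ∨ a² < 4b)`.**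
[cite: GreenbergLNM1716, §5 Remark (chunk p0174)] -/
theorem forall_root_le_zero_iff_sign_of_isTwoTorsionNF :
    (∀ r : ℝ, 4 * r ^ 3 + (V.b₂ : ℝ) * r ^ 2 + 2 * (V.b₄ : ℝ) * r + (V.b₆ : ℝ) = 0 → r ≤ 0) ↔
      0 < V.a₄ ∧ (0 < V.a₂ ∨ V.a₂ ^ 2 < 4 * V.a₄) := by
  rw [forall_root_le_zero_iff_of_isTwoTorsionNF]
  have hb : (V.a₄ : ℝ) ≠ 0 := by exact_mod_cast V.a₄_ne_zero
  have hab : (V.a₂ : ℝ) ^ 2 - 4 * (V.a₄ : ℝ) ≠ 0 := by exact_mod_cast V.a₂_sq_sub_ne_zero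
  rw [forall_root_nonpos_iff_sign hb hab]
  constructor
  · rintro ⟨h1, h2 | h2⟩
    · exact ⟨by exact_mod_cast h1, Or.inl (by exact_mod_cast h2)⟩
    · exact ⟨by exact_mod_cast h1, Or.inr (by exact_mod_cast h2)⟩
  · rintro ⟨h1, h2 | h2⟩
    · exact ⟨by exact_mod_cast h1, Or.inl (by exact_mod_cast h2)⟩
    · exact ⟨by exact_mod_cast h1, Or.inr (by exact_mod_cast h2)⟩

end NF

/-! ### §3. For any model: the sign test in `α = b₂ + 12x`, `β = b₄ + x b₂ + 6x²` -/

section Sign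

variable (W : WeierstrassCurve ℚ) [W.IsElliptic] (C : VariableChange ℚ)

omit [W.IsElliptic] in
/-- Signs on the normal form `C • W` versus `α, β` on `W`: `a₂ = u⁻²α/4`, `a₄ = u⁻⁴β/2`, so
`(0 < a₄ ↔ 0 < β)`, `(a₂ < 0 ↔ α < 0)`, `(0 < a₂ ↔ 0 < α)`, `(a₂² < 4a₄ ↔ α² < 32β)`.
[cite: SilvermanAEC2009, III.1 Table 3.1] -/
theorem sign_nf_iff_sign [(C • W).IsTwoTorsionNF] :
    (0 < (C • W).a₄ ↔ 0 < W.b₄ + C.r * W.b₂ + 6 * C.r ^ 2) ∧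
      ((C • W).a₂ < 0 ↔ W.b₂ + 12 * C.r < 0) ∧ (0 < (C • W).a₂ ↔ 0 < W.b₂ + 12 * C.r) ∧
      ((C • W).a₂ ^ 2 < 4 * (C • W).a₄ ↔ (W.b₂ + 12 * C.r) ^ 2 < 32 * (W.b₄ + C.r * W.b₂ + 6 * C.r ^ 2)) := by
  have h2 := four_mul_a₂_of_isTwoTorsionNF_smul W C
  have h4 := two_mul_a₄_of_isTwoTorsionNF_smul W C
  set U : ℚ := ((C.u⁻¹ : ℚˣ) : ℚ) with hU
  have hU0 : U ≠ 0 := Units.ne_zero _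
  have hU2 : 0 < U ^ 2 := by positivity
  have hU4 : 0 < U ^ 4 := by positivity
  have ha₂ : (C • W).a₂ = U ^ 2 * (W.b₂ + 12 * C.r) / 4 := by rw [← h2]; ring
  have ha₄ : (C • W).a₄ = U ^ 4 * (W.b₄ + C.r * W.b₂ + 6 * C.r ^ 2) / 2 := by rw [← h4]; ring
  set α := W.b₂ + 12 * C.r with hα
  set β := W.b₄ + C.r * W.b₂ + 6 * C.r ^ 2 with hβ
  refine ⟨?_, ?_, ?_, ?_⟩
  · rw [ha₄]
    constructor
    · intro h; by_contra h'; exact absurd h (not_lt.mpr (by nlinarith [not_lt.mp h']))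
    · intro h; positivity
  · rw [ha₂]
    constructor
    · intro h; by_contra h'; exact absurd h (not_lt.mpr (by nlinarith [not_lt.mp h']))
    · intro h; nlinarith
  · rw [ha₂]
    constructor
    · intro h; by_contra h'; exact absurd h (not_lt.mpr (by nlinarith [not_lt.mp h']))
    · intro h; positivity
  · rw [ha₂, ha₄]
    have key : (U ^ 2 * α / 4) ^ 2 - 4 * (U ^ 4 * β / 2) = U ^ 4 * (α ^ 2 - 32 * β) / 16 := by ring
    constructor
    · intro h
      have : (U ^ 2 * α / 4) ^ 2 - 4 * (U ^ 4 * β / 2) < 0 := by linarith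
      rw [key] at this
      nlinarith
    · intro h
      have : U ^ 4 * (α ^ 2 - 32 * β) / 16 < 0 := by nlinarith
      rw [← key] at this
      linarith

/-- **Greenberg's «odd» as an exact sign test**: for a rational point `P = (C.r, C.t)` of order `2` exhibited by a normal
form `C • W`, `⟨P⟩ ⊆ C_∞` (`x(P)` is the least real `2`-torsion abscissa) iff `0 < β ∧ (α < 0 ∨ α² < 32β)`,
`α = b₂ + 12x(P)`, `β = b₄ + x(P)b₂ + 6x(P)²`. [cite: GreenbergLNM1716, §5 Remark (chunks p0170, p0174)] -/
theorem twoTorsionOdd_iff_sign [(C • W).IsTwoTorsionNF] :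
    TwoTorsionOdd W C.r ↔ 0 < W.b₄ + C.r * W.b₂ + 6 * C.r ^ 2 ∧
      (W.b₂ + 12 * C.r < 0 ∨ (W.b₂ + 12 * C.r) ^ 2 < 32 * (W.b₄ + C.r * W.b₂ + 6 * C.r ^ 2)) := by
  have h1 : TwoTorsionOdd W C.r ↔ TwoTorsionOdd (C • W) 0 := by rw [twoTorsionOdd_smul_iff]; simp
  obtain ⟨hb, hneg, -, hD⟩ := sign_nf_iff_sign W C
  rw [h1, twoTorsionOdd_zero_iff_sign_of_isTwoTorsionNF, hb, hneg, hD]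

/-- **Co-odd as an exact sign test**: `x(P)` is the LARGEST real `2`-torsion abscissa iff
`0 < β ∧ (0 < α ∨ α² < 32β)`. [cite: GreenbergLNM1716, §5 Remark (chunk p0174)] -/
theorem forall_root_le_iff_sign [(C • W).IsTwoTorsionNF] :
    (∀ r : ℝ, 4 * r ^ 3 + (W.b₂ : ℝ) * r ^ 2 + 2 * (W.b₄ : ℝ) * r + (W.b₆ : ℝ) = 0 → r ≤ (C.r : ℝ)) ↔
      0 < W.b₄ + C.r * W.b₂ + 6 * C.r ^ 2 ∧
      (0 < W.b₂ + 12 * C.r ∨ (W.b₂ + 12 * C.r) ^ 2 < 32 * (W.b₄ + C.r * W.b₂ + 6 * C.r ^ 2)) := by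
  have h3 := forall_root_le_smul_iff W C 0
  simp only [Rat.cast_zero, mul_zero, zero_add] at h3
  obtain ⟨hb, -, hpos, hD⟩ := sign_nf_iff_sign W C
  rw [← h3, forall_root_le_zero_iff_sign_of_isTwoTorsionNF, hb, hpos, hD]

/-- **`sign Δ` as a sign test**: `Δ < 0 ⟺ α² < 32β` and `0 < Δ ⟺ 32β < α²` (`4Δ = β²(α² − 32β)`, `β ≠ 0`).
[cite: SilvermanAEC2009, III.1 (Δ) and III.4 Example 4.5] -/
theorem Δ_neg_iff_sign [(C • W).IsTwoTorsionNF] :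
    (W.Δ < 0 ↔ (W.b₂ + 12 * C.r) ^ 2 < 32 * (W.b₄ + C.r * W.b₂ + 6 * C.r ^ 2)) ∧
      (0 < W.Δ ↔ 32 * (W.b₄ + C.r * W.b₂ + 6 * C.r ^ 2) < (W.b₂ + 12 * C.r) ^ 2) := by
  have h4Δ := four_mul_Δ_eq_of_isTwoTorsionNF_smul W C
  set α := W.b₂ + 12 * C.r with hα
  set β := W.b₄ + C.r * W.b₂ + 6 * C.r ^ 2 with hβ
  have hβ0 : β ≠ 0 := by
    intro h0
    have h4 := two_mul_a₄_of_isTwoTorsionNF_smul W C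
    rw [← hβ, h0, mul_zero] at h4
    exact (C • W).a₄_ne_zero (by linarith)
  have hβ2 : 0 < β ^ 2 := by positivity
  have hΔ : W.Δ = β ^ 2 * (α ^ 2 - 32 * β) / 4 := by linear_combination h4Δ / 4
  rw [hΔ]
  constructor
  · constructor
    · intro h; by_contra h'; exact absurd h (not_lt.mpr (by nlinarith [not_lt.mp h']))
    · intro h; nlinarith
  · constructor
    · intro h; by_contra h'; exact absurd h (not_lt.mpr (by nlinarith [not_lt.mp h']))
    · intro h; nlinarith

/-- Abscissa form of the odd test (`P = (x, y)` with `HasRationalTwoTorsionX W x`; the normal form is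
`(1, x, -a₁/2, y) • W`). [cite: GreenbergLNM1716, §5 Remark (chunks p0170, p0174)] -/
theorem twoTorsionOdd_iff_sign' {x : ℚ} (hx : HasRationalTwoTorsionX W x) :
    TwoTorsionOdd W x ↔ 0 < W.b₄ + x * W.b₂ + 6 * x ^ 2 ∧
      (W.b₂ + 12 * x < 0 ∨ (W.b₂ + 12 * x) ^ 2 < 32 * (W.b₄ + x * W.b₂ + 6 * x ^ 2)) := by
  obtain ⟨y, hEq, h2⟩ := hx
  set C : VariableChange ℚ := ⟨1, x, -W.a₁ / 2, y⟩ with hC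
  have hns : W.toAffine.Nonsingular x y := (WeierstrassCurve.Affine.equation_iff_nonsingular).mp hEq
  have hy : y = W.toAffine.negY x y := by
    rw [WeierstrassCurve.Affine.negY]; linear_combination h2
  haveI : (C • W).IsTwoTorsionNF := isTwoTorsionNF_smul_of_two_nsmul_eq_zero two_ne_zero hns hy
  exact twoTorsionOdd_iff_sign W C

/-- Abscissa form of the co-odd test. [cite: GreenbergLNM1716, §5 Remark (chunk p0174)] -/
theorem forall_root_le_iff_sign' {x : ℚ} (hx : HasRationalTwoTorsionX W x) :
    (∀ r : ℝ, 4 * r ^ 3 + (W.b₂ : ℝ) * r ^ 2 + 2 * (W.b₄ : ℝ) * r + (W.b₆ : ℝ) = 0 → r ≤ (x : ℝ)) ↔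
      0 < W.b₄ + x * W.b₂ + 6 * x ^ 2 ∧
      (0 < W.b₂ + 12 * x ∨ (W.b₂ + 12 * x) ^ 2 < 32 * (W.b₄ + x * W.b₂ + 6 * x ^ 2)) := by
  obtain ⟨y, hEq, h2⟩ := hx
  set C : VariableChange ℚ := ⟨1, x, -W.a₁ / 2, y⟩ with hC
  have hns : W.toAffine.Nonsingular x y := (WeierstrassCurve.Affine.equation_iff_nonsingular).mp hEq
  have hy : y = W.toAffine.negY x y := by
    rw [WeierstrassCurve.Affine.negY]; linear_combination h2
  haveI : (C • W).IsTwoTorsionNF := isTwoTorsionNF_smul_of_two_nsmul_eq_zero two_ne_zero hns hy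
  exact forall_root_le_iff_sign W C

/-- Abscissa form of the `Δ`-sign test. [cite: SilvermanAEC2009, III.1 (Δ)] -/
theorem Δ_neg_iff_sign' {x : ℚ} (hx : HasRationalTwoTorsionX W x) :
    (W.Δ < 0 ↔ (W.b₂ + 12 * x) ^ 2 < 32 * (W.b₄ + x * W.b₂ + 6 * x ^ 2)) ∧
      (0 < W.Δ ↔ 32 * (W.b₄ + x * W.b₂ + 6 * x ^ 2) < (W.b₂ + 12 * x) ^ 2) := by
  obtain ⟨y, hEq, h2⟩ := hx
  set C : VariableChange ℚ := ⟨1, x, -W.a₁ / 2, y⟩ with hC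
  have hns : W.toAffine.Nonsingular x y := (WeierstrassCurve.Affine.equation_iff_nonsingular).mp hEq
  have hy : y = W.toAffine.negY x y := by
    rw [WeierstrassCurve.Affine.negY]; linear_combination h2
  haveI : (C • W).IsTwoTorsionNF := isTwoTorsionNF_smul_of_two_nsmul_eq_zero two_ne_zero hns hy
  exact Δ_neg_iff_sign W C

end Sign

/-! ### §4. Decidable forms of Greenberg's configurations (good ordinary or multiplicative at `2`) -/

section Decide

variable (W : WeierstrassCurve ℚ) [W.IsElliptic]

/-- **Prop. 5.13's hypothesis («ramified AND odd») as a test on `(x, α, β)`**: `v₂(x) < 0 ∧ 0 < β ∧ (α < 0 ∨ α² < 32β)`.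
[cite: GreenbergLNM1716, Prop. 5.13 (chunk p0168) and Remark (chunk p0170)] -/
theorem prop513Hypothesis_iff_sign {x : ℚ} (hx : HasRationalTwoTorsionX W x) :
    (TwoTorsionRamifiedAtTwo x ∧ TwoTorsionOdd W x) ↔
      padicValRat 2 x < 0 ∧ 0 < W.b₄ + x * W.b₂ + 6 * x ^ 2 ∧
        (W.b₂ + 12 * x < 0 ∨ (W.b₂ + 12 * x) ^ 2 < 32 * (W.b₄ + x * W.b₂ + 6 * x ^ 2)) := by
  rw [twoTorsionOdd_iff_sign' W hx]
  exact Iff.rfl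

/-- **Prop. 5.14's hypothesis («ramified XOR odd») as a test on `(x, α, β)`.**
[cite: GreenbergLNM1716, Prop. 5.14 (chunk p0170) and Remark (chunk p0170)] -/
theorem prop514Hypothesis_iff_sign {x : ℚ} (hx : HasRationalTwoTorsionX W x) :
    ((TwoTorsionRamifiedAtTwo x ∧ ¬ TwoTorsionOdd W x) ∨ (TwoTorsionOdd W x ∧ ¬ TwoTorsionRamifiedAtTwo x)) ↔
      ((padicValRat 2 x < 0 ∧ ¬ (0 < W.b₄ + x * W.b₂ + 6 * x ^ 2 ∧
          (W.b₂ + 12 * x < 0 ∨ (W.b₂ + 12 * x) ^ 2 < 32 * (W.b₄ + x * W.b₂ + 6 * x ^ 2)))) ∨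
        ((0 < W.b₄ + x * W.b₂ + 6 * x ^ 2 ∧
          (W.b₂ + 12 * x < 0 ∨ (W.b₂ + 12 * x) ^ 2 < 32 * (W.b₄ + x * W.b₂ + 6 * x ^ 2))) ∧
          ¬ padicValRat 2 x < 0)) := by
  rw [twoTorsionOdd_iff_sign' W hx]
  exact Iff.rfl

end Decide

end Literature.NumberTheory.EllipticCurves.Greenberg1999
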